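import Literature.Probability.Percolation.BoundaryFunctionalBound
import Literature.Probability.Percolation.SharpnessQuasiTransitiveProofs
import Summits.CriticalPhenomena.PercolationContinuityZ3.Theorems.Transplant.GrigorchukPowerTraceMonotonicity
import HarnessLib

/-!
# Hutchcroft's Lemma 2.1 on a vertex-transitive graph of bounded degree: `(χ|S| − Σ_{u,v∈S} τ(u,v))² ≤ p² · Σ_{u,v,w∈S} τ(u,v)τ(u,w) · (D χ Φ_p(S))`

Definition + proof file (`--kind definition`: the five real functionals; `--supports stmt-CriticalPhenomena-4575 --as helper`), lane `prim-bschramm`, seat `prim-bschramm-gen-1`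
gen 12 (GEN pen); first half of item (b) of the Q-DOOR-2 port table (NOTES-g12-mirror §HANDOFF-QDOOR2, lead g29 #10068): the generic twin of the `§Zd` half of
«BoundaryFunctionalBound.lean» (its `§LastExit` half — `real_openConn_le_lastExit` — is already generic and is imported).  builds on p205010 (kernel theorem, internal
audit signed; external expert review pending) — nothing here uses p205010.  No instance, no notation, no sorry; nothing about `θ(p_c)`.

PORT DICTIONARY: `tau d p x y` ↦ `NcHaraSlade.conn G p x y`; `chi d p` ↦ the real susceptibility `Σ'_x τ_p(ρ, x)` at a root `ρ` (root-free by transitivity,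
`tsum_conn_eq_of_transitive`); lattice translations ↦ automorphisms (E4.3c `conn_iso`); `2d` ↦ a degree bound `D` (`∀ a, deg a ≤ D`); `d ≥ 2, p < p_c` ↦
`G` connected + vertex-transitive + `p < p_c(ρ)` (summability of `τ_p(b, ·)` from DCTQ sharpness «SharpnessQuasiTransitiveProofs» `summable_real_openConn_of_lt_criticalProb`).
* defs `offSum`, `boundaryPhiR`, `connRow`, `sqSum`, `exitMass` (verbatim shapes of the ℤ^d file, over `G`);
* `summable_conn_left`, `tsum_conn_eq_of_transitive`, `offSum_le_tsum_conn`, `boundaryPhi_eq_ofReal` (link to «ClusterBoundary» `boundaryPhi`), `sum_offSum_le`,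
  `exitMass_eq`, and **`lemma21_transitive`**: `exitMass² ≤ p² · sqSum · (D · χ · boundaryPhiR)`.
[cite: Hutchcroft2022Triangle, Lemma 2.1 and its proof ((2.2))] [cite: GrimmettPercolation1999, §2.3 (2.17) (BK)]
-/

noncomputable section

namespace Summit.CriticalPhenomena.PercolationContinuityZ3.Theorems.Transplant

namespace Grigorchuk

namespace NcHaraSlade

open SimpleGraph Finset MeasureTheory Filter Topology Literature.Probability.Percolation Literature.Barriers.CriticalPhenomena
open scoped ENNReal

variable {V : Type} [DecidableEq V] (G : SimpleGraph V) [G.LocallyFinite] [DecidableRel G.Adj]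

/-! ## §1 The real functionals -/

/-- `Σ_x P_p(b ↔ x off S)` (inner sum of Hutchcroft's `Φ_p(S)`), a real `tsum`. [cite: Hutchcroft2022Triangle, §2 (definition of Φ_β(S))] -/
def offSum (G : SimpleGraph V) (p : unitInterval) (S : Finset V) (b : V) : ℝ :=
  ∑' x : V, (bondPercolation G p).real (openConnIn ((↑S : Set V)ᶜ) b x)

/-- Hutchcroft's `Φ_p(S) = Σ_{a∈S} Σ_{b∼a, b∉S} Σ_x P_p(b ↔ x off S)` as a real number. [cite: Hutchcroft2022Triangle, §2 (definition of Φ_β(S))] -/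
def boundaryPhiR (G : SimpleGraph V) [G.LocallyFinite] (p : unitInterval) (S : Finset V) : ℝ :=
  ∑ a ∈ S, ∑ b ∈ (G.neighborFinset a).filter (· ∉ S), offSum G p S b

/-- `Σ_{u∈S} τ_p(u, a)` (the `a`-entry of `T_p 𝟙_S`). [cite: Hutchcroft2022Triangle, Lemma 2.1 (proof)] -/
def connRow (G : SimpleGraph V) (p : unitInterval) (S : Finset V) (a : V) : ℝ := ∑ u ∈ S, conn G p u a

/-- `Σ_{a∈S} (Σ_{u∈S} τ(u,a))²`. [cite: Hutchcroft2022Triangle, Lemma 2.1] -/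
def sqSum (G : SimpleGraph V) (p : unitInterval) (S : Finset V) : ℝ := ∑ a ∈ S, connRow G p S a ^ 2

/-- `Σ_{u∈S} Σ_{w∉S} τ(u,w)` (`= χ|S| − Σ_{u,v∈S} τ(u,v)` below `p_c`). [cite: Hutchcroft2022Triangle, Lemma 2.1 (proof, last display)] -/
def exitMass (G : SimpleGraph V) (p : unitInterval) (S : Finset V) : ℝ :=
  ∑ u ∈ S, ∑' w : V, (if w ∈ S then 0 else conn G p u w)

/-! ## §2 Summability and root-freeness below `p_c` on a transitive graph -/

omit [DecidableEq V] [DecidableRel G.Adj] in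
/-- `x ↦ τ_p(b, x)` is summable for `p < p_c(ρ)` on a connected vertex-transitive graph (DCTQ sharpness). [cite: DuminilCopinTassionCMP2016, Thm. 1.1(2)] [cite: AntunovicVeselic2007, Thm. 2] -/
theorem summable_conn_left (htr : IsGraphTransitive G) (hconn : G.Connected) {p : unitInterval} {ρ : V} (hp : (p : ℝ) < criticalProb G ρ) (b : V) :
    Summable fun x : V => conn G p b x := by
  haveI : Countable V := countable_of_connected_of_locallyFinite G hconn ρ
  have hV₀ : ∀ v : V, ∃ γ : G ≃g G, γ v ∈ ({ρ} : Finset V) := fun v => by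
    obtain ⟨γ, hγ⟩ := htr v ρ
    exact ⟨γ, by rw [hγ]; exact Finset.mem_singleton_self ρ⟩
  have hpb : (p : ℝ) < criticalProb G b := by rw [criticalProb_eq_of_reachable G (hconn.preconnected b ρ)]; exact hp
  exact DCTQ.summable_real_openConn_of_lt_criticalProb G hconn hV₀ b p hpb

omit [DecidableEq V] [G.LocallyFinite] [DecidableRel G.Adj] in
/-- `Σ_x τ_p(b, x) = Σ_x τ_p(ρ, x)` on a vertex-transitive graph. [folklore] -/
theorem tsum_conn_eq_of_transitive (htr : IsGraphTransitive G) (p : unitInterval) (ρ b : V) :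
    ∑' x : V, conn G p b x = ∑' x : V, conn G p ρ x := by
  obtain ⟨γ, hγ⟩ := htr ρ b
  rw [← hγ, ← γ.toEquiv.tsum_eq (fun x => conn G p (γ ρ) x)]
  exact tsum_congr fun x => by simp only [RelIso.coe_fn_toEquiv, conn_iso]

omit [DecidableEq V] [DecidableRel G.Adj] in
/-- The off-`S` connection probabilities are summable below `p_c`. [folklore] -/
theorem summable_offSum_summand (htr : IsGraphTransitive G) (hconn : G.Connected) {p : unitInterval} {ρ : V} (hp : (p : ℝ) < criticalProb G ρ)
    (S : Finset V) (b : V) : Summable fun x : V => (bondPercolation G p).real (openConnIn ((↑S : Set V)ᶜ) b x) :=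
  (summable_conn_left G htr hconn hp b).of_nonneg_of_le (fun _ => measureReal_nonneg)
    fun x => measureReal_mono (openConnIn_subset_openConn _ b x) (measure_ne_top _ _)

omit [DecidableEq V] [DecidableRel G.Adj] in
/-- `offSum ≤ χ`. [folklore] -/
theorem offSum_le_tsum_conn (htr : IsGraphTransitive G) (hconn : G.Connected) {p : unitInterval} {ρ : V} (hp : (p : ℝ) < criticalProb G ρ)
    (S : Finset V) (b : V) : offSum G p S b ≤ ∑' x : V, conn G p ρ x := by
  rw [offSum, ← tsum_conn_eq_of_transitive G htr p ρ b]
  exact (summable_offSum_summand G htr hconn hp S b).tsum_le_tsum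
    (fun x => measureReal_mono (openConnIn_subset_openConn _ b x) (measure_ne_top _ _)) (summable_conn_left G htr hconn hp b)

omit [DecidableEq V] [G.LocallyFinite] [DecidableRel G.Adj] in
/-- `offSum ≥ 0`. [folklore] -/
theorem offSum_nonneg (p : unitInterval) (S : Finset V) (b : V) : 0 ≤ offSum G p S b := tsum_nonneg fun _ => measureReal_nonneg

omit [DecidableRel G.Adj] in
/-- `Φ ≥ 0`. [folklore] -/
theorem boundaryPhiR_nonneg (p : unitInterval) (S : Finset V) : 0 ≤ boundaryPhiR G p S :=
  Finset.sum_nonneg fun _ _ => Finset.sum_nonneg fun b _ => offSum_nonneg G p S b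

omit [DecidableRel G.Adj] in
/-- The `ℝ≥0∞`-valued `Φ` of «ClusterBoundary» is `ofReal` of the real one (below `p_c`). [cite: Hutchcroft2022Triangle, §2 (definition of Φ_β(S))] -/
theorem boundaryPhi_eq_ofReal (htr : IsGraphTransitive G) (hconn : G.Connected) {p : unitInterval} {ρ : V} (hp : (p : ℝ) < criticalProb G ρ) (S : Finset V) :
    boundaryPhi G p S = ENNReal.ofReal (boundaryPhiR G p S) := by
  rw [boundaryPhiR, ENNReal.ofReal_sum_of_nonneg (fun a _ => Finset.sum_nonneg fun b _ => offSum_nonneg G p S b), boundaryPhi]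
  refine Finset.sum_congr rfl fun a _ => ?_
  rw [ENNReal.ofReal_sum_of_nonneg (fun b _ => offSum_nonneg G p S b)]
  refine Finset.sum_congr rfl fun b _ => ?_
  rw [offSum, ENNReal.ofReal_tsum_of_nonneg (fun _ => measureReal_nonneg) (summable_offSum_summand G htr hconn hp S b)]
  exact tsum_congr fun x => (ofReal_measureReal (measure_ne_top _ _)).symm

omit [DecidableRel G.Adj] in
/-- `Σ_{b ∼ a, b ∉ S} offSum ≤ D χ` under a degree bound `deg ≤ D`. [folklore] -/
theorem sum_offSum_le (htr : IsGraphTransitive G) (hconn : G.Connected) {p : unitInterval} {ρ : V} (hp : (p : ℝ) < criticalProb G ρ) {D : ℕ}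
    (hdeg : ∀ a : V, G.degree a ≤ D) (S : Finset V) (a : V) :
    ∑ b ∈ (G.neighborFinset a).filter (· ∉ S), offSum G p S b ≤ D * ∑' x : V, conn G p ρ x := by
  have hχ : 0 ≤ ∑' x : V, conn G p ρ x := tsum_nonneg fun x => conn_nonneg G p ρ x
  calc ∑ b ∈ (G.neighborFinset a).filter (· ∉ S), offSum G p S b
      ≤ ∑ b ∈ G.neighborFinset a, offSum G p S b :=
        Finset.sum_le_sum_of_subset_of_nonneg (Finset.filter_subset _ _) fun b _ _ => offSum_nonneg G p S b
    _ ≤ ∑ _b ∈ G.neighborFinset a, ∑' x : V, conn G p ρ x := Finset.sum_le_sum fun b _ => offSum_le_tsum_conn G htr hconn hp S b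
    _ = G.degree a * ∑' x : V, conn G p ρ x := by rw [Finset.sum_const, nsmul_eq_mul, card_neighborFinset_eq_degree]
    _ ≤ D * ∑' x : V, conn G p ρ x := mul_le_mul_of_nonneg_right (by exact_mod_cast hdeg a) hχ

omit [DecidableRel G.Adj] in
/-- The indicator summand of `exitMass` is summable below `p_c`. [folklore] -/
theorem summable_exitMass_summand (htr : IsGraphTransitive G) (hconn : G.Connected) {p : unitInterval} {ρ : V} (hp : (p : ℝ) < criticalProb G ρ)
    (S : Finset V) (u : V) : Summable fun w : V => (if w ∈ S then (0 : ℝ) else conn G p u w) :=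
  (summable_conn_left G htr hconn hp u).of_nonneg_of_le
    (fun w => by split_ifs <;> [exact le_rfl; exact conn_nonneg G p u w])
    (fun w => by split_ifs <;> [exact conn_nonneg G p u w; exact le_rfl])

omit [G.LocallyFinite] [DecidableRel G.Adj] in
/-- `exitMass ≥ 0`. [folklore] -/
theorem exitMass_nonneg (p : unitInterval) (S : Finset V) : 0 ≤ exitMass G p S :=
  Finset.sum_nonneg fun u _ => tsum_nonneg fun w => by split_ifs <;> [exact le_rfl; exact conn_nonneg G p u w]

omit [DecidableRel G.Adj] in
/-- **`exitMass S = χ|S| − Σ_{u,v∈S} τ(u,v)`** below `p_c` on a connected vertex-transitive graph. [cite: Hutchcroft2022Triangle, Lemma 2.1 (proof, last display)] -/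
theorem exitMass_eq (htr : IsGraphTransitive G) (hconn : G.Connected) {p : unitInterval} {ρ : V} (hp : (p : ℝ) < criticalProb G ρ) (S : Finset V) :
    exitMass G p S = (∑' x : V, conn G p ρ x) * S.card - ∑ u ∈ S, ∑ v ∈ S, conn G p u v := by
  have key : ∀ u : V, ∑' w : V, (if w ∈ S then (0 : ℝ) else conn G p u w) = (∑' x : V, conn G p ρ x) - ∑ v ∈ S, conn G p u v := by
    intro u
    have hs := summable_conn_left G htr hconn hp u
    have h1 := hs.sum_add_tsum_compl (s := S)
    rw [← tsum_conn_eq_of_transitive G htr p ρ u, ← h1]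
    have h2 : ∑' w : V, (if w ∈ S then (0 : ℝ) else conn G p u w) = ∑' w : ↑((↑S : Set V)ᶜ), conn G p u w := by
      rw [tsum_subtype ((↑S : Set V)ᶜ) (fun w => conn G p u w)]
      refine tsum_congr fun w => ?_
      rw [Set.indicator_apply]
      by_cases hw : w ∈ S
      · rw [if_pos hw, if_neg (by simpa using hw)]
      · rw [if_neg hw, if_pos (by simpa using hw)]
    rw [h2]; ring
  rw [exitMass]
  simp_rw [key]
  rw [Finset.sum_sub_distrib, Finset.sum_const, nsmul_eq_mul, mul_comm]

/-! ## §3 Lemma 2.1 -/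

/-- **Hutchcroft's Lemma 2.1 on a connected vertex-transitive graph with degrees `≤ D`** (with `P(e open) = p` for `1 − e^{−βJ_e} ≤ βJ_e`): for `p < p_c(ρ)` and
every finite `S`, `(χ|S| − Σ_{u,v∈S} τ(u,v))² ≤ p² · Σ_{a∈S}(Σ_{u∈S} τ(u,a))² · (D χ Φ_p(S))`, i.e. `Φ_p(S) ≥ exitMass² / (D p² χ sqSum)`.  Proof verbatim as on `ℤ^d`:
sum the last-exit BK bound («BoundaryFunctionalBound» `real_openConn_le_lastExit`, generic) over `u ∈ S`, `w ∉ S`; Cauchy–Schwarz in `a`; `‖f‖₂² ≤ ‖f‖_∞‖f‖₁` with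
`‖f‖_∞ ≤ Dχ`. [cite: Hutchcroft2022Triangle, Lemma 2.1] -/
theorem lemma21_transitive (htr : IsGraphTransitive G) (hconn : G.Connected) {p : unitInterval} {ρ : V} (hp : (p : ℝ) < criticalProb G ρ) {D : ℕ}
    (hdeg : ∀ a : V, G.degree a ≤ D) (S : Finset V) :
    exitMass G p S ^ 2 ≤ (p : ℝ) ^ 2 * sqSum G p S * (D * (∑' x : V, conn G p ρ x) * boundaryPhiR G p S) := by
  haveI : Countable V := countable_of_connected_of_locallyFinite G hconn ρ
  set μ := bondPercolation G p with hμ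
  set N : V → Finset V := fun a => (G.neighborFinset a).filter (· ∉ S) with hN
  set f : V → ℝ := fun a => ∑ b ∈ N a, offSum G p S b with hf
  set χ : ℝ := ∑' x : V, conn G p ρ x with hχdef
  have hf0 : ∀ a, 0 ≤ f a := fun a => Finset.sum_nonneg fun b _ => offSum_nonneg G p S b
  have hfle : ∀ a, f a ≤ D * χ := fun a => sum_offSum_le G htr hconn hp hdeg S a
  have hp0 : 0 ≤ (p : ℝ) := p.2.1
  -- Step 1: `exitMass ≤ p Σ_{a ∈ S} connRow(a) f(a)`
  have h1 : exitMass G p S ≤ (p : ℝ) * ∑ a ∈ S, connRow G p S a * f a := by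
    have hterm : ∀ u ∈ S, ∀ w : V, (if w ∈ S then (0 : ℝ) else conn G p u w) ≤
        ∑ a ∈ S, ∑ b ∈ N a, conn G p u a * ((p : ℝ) * μ.real (openConnIn ((↑S : Set V)ᶜ) b w)) := by
      intro u hu w
      split_ifs with hw
      · exact Finset.sum_nonneg fun a _ => Finset.sum_nonneg fun b _ => mul_nonneg (conn_nonneg G p u a) (mul_nonneg hp0 measureReal_nonneg)
      · exact real_openConn_le_lastExit G p S hu hw
    have hsumm : ∀ u a b, Summable fun w : V => conn G p u a * ((p : ℝ) * μ.real (openConnIn ((↑S : Set V)ᶜ) b w)) :=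
      fun u a b => ((summable_offSum_summand G htr hconn hp S b).mul_left _).mul_left _
    calc exitMass G p S
        ≤ ∑ u ∈ S, ∑' w : V, ∑ a ∈ S, ∑ b ∈ N a, conn G p u a * ((p : ℝ) * μ.real (openConnIn ((↑S : Set V)ᶜ) b w)) := by
          refine Finset.sum_le_sum fun u hu => ?_
          refine (summable_exitMass_summand G htr hconn hp S u).tsum_le_tsum (hterm u hu) ?_
          exact summable_sum fun a _ => summable_sum fun b _ => hsumm u a b
      _ = ∑ u ∈ S, ∑ a ∈ S, ∑ b ∈ N a, conn G p u a * ((p : ℝ) * offSum G p S b) := by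
          refine Finset.sum_congr rfl fun u _ => ?_
          rw [Summable.tsum_finsetSum (fun a _ => summable_sum fun b _ => hsumm u a b)]
          refine Finset.sum_congr rfl fun a _ => ?_
          rw [Summable.tsum_finsetSum (fun b _ => hsumm u a b)]
          refine Finset.sum_congr rfl fun b _ => ?_
          rw [tsum_mul_left, tsum_mul_left, offSum]
      _ = (p : ℝ) * ∑ a ∈ S, connRow G p S a * f a := by
          rw [Finset.sum_comm, Finset.mul_sum]
          refine Finset.sum_congr rfl fun a _ => ?_
          simp only [hf, connRow]
          rw [Finset.sum_mul_sum, Finset.mul_sum]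
          refine Finset.sum_congr rfl fun u _ => ?_
          rw [Finset.mul_sum]
          refine Finset.sum_congr rfl fun b _ => ?_
          ring
  -- Step 2: Cauchy–Schwarz and `Σ f² ≤ Dχ Σ f`
  have h2 : (∑ a ∈ S, connRow G p S a * f a) ^ 2 ≤ sqSum G p S * ∑ a ∈ S, f a ^ 2 := Finset.sum_mul_sq_le_sq_mul_sq S _ _
  have h3 : ∑ a ∈ S, f a ^ 2 ≤ D * χ * boundaryPhiR G p S := by
    rw [boundaryPhiR, Finset.mul_sum]
    refine Finset.sum_le_sum fun a _ => ?_
    rw [sq]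
    exact mul_le_mul_of_nonneg_right (hfle a) (hf0 a)
  have hX := exitMass_nonneg G p S
  have hsq : exitMass G p S ^ 2 ≤ ((p : ℝ) * ∑ a ∈ S, connRow G p S a * f a) ^ 2 := pow_le_pow_left₀ hX h1 2
  have hY : 0 ≤ sqSum G p S := Finset.sum_nonneg fun a _ => sq_nonneg _
  calc exitMass G p S ^ 2 ≤ (p : ℝ) ^ 2 * (∑ a ∈ S, connRow G p S a * f a) ^ 2 := by rw [← mul_pow]; exact hsq
    _ ≤ (p : ℝ) ^ 2 * (sqSum G p S * ∑ a ∈ S, f a ^ 2) := mul_le_mul_of_nonneg_left h2 (sq_nonneg _)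
    _ ≤ (p : ℝ) ^ 2 * (sqSum G p S * (D * χ * boundaryPhiR G p S)) := mul_le_mul_of_nonneg_left (mul_le_mul_of_nonneg_left h3 hY) (sq_nonneg _)
    _ = _ := by ring

end NcHaraSlade

end Grigorchuk

end Summit.CriticalPhenomena.PercolationContinuityZ3.Theorems.Transplant

end
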